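import Summits.ABC.StewartYu.PrimePadicSocketRad
import HarnessLib

/-!
# Cell abc-stewartyu: the prime-argument `p`-adic SOCKET of the abc assembly, V —
# socket A⁺ at the ODD primes (no `2`-adic input, no archimedean input)

`Summits/ABC/StewartYu/PrimePadicSocketOdd.lean` — cell `abc-stewartyu` (HOME
`run/shared/lean/pub/abc-stewartyu/`, seat p3; theorems only, no definition, no named fact), sequel to
`PrimePadicSocketRad.lean` and `PrimePadicSocket.lean`.

**Socket A⁺ at the odd primes** (`bakerShapeBound_of_oddPrimePadicBound_general`). If the class bound
of socket A⁺,

  `ord_p(q₁^{e₁}⋯qₙ^{eₙ} − 1) ≤ K · Lⁿ · n^{κn} · p^σ · (log q₁ ⋯ log qₙ) ·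
      (log max(3, max|eᵢ|) + log p + ∑ᵢ log qᵢ)^{τ₀ + τ₁ n}`

(distinct primes `qᵢ ≠ p`, `e ≠ 0`, `∏ qᵢ^{eᵢ} ≠ 1`), holds for every ODD prime `p ≥ 3`, then already
`log c ≤ C · rad(abc)^{κ+σ+3τ₁+1}` for every abc triple (`BakerShapeBound (κ+σ+3τ₁+1) 0`), and
`stewartTijdeman1986_upperBound` (`log c ≤ κ R^{15}` [cite: StewartTijdeman1986, Theorem 1 (upper
bound), as quoted in Waldschmidt2014 §2 (PDF p. 3)]) when `κ + σ + 3τ₁ + 1 ≤ 15`. Reason: if `c` is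
odd, expand `c = ∑_{p ∣ c} ord_p(c) log p` at its (odd) primes; if `c` is even, `a` and `b` are odd and
(for `a < b`) `c < 2b`, so expand `b` (`b ∣ c² − a²`) and absorb `log 2` in the constant
(`log_oddMember_le`). So the `p`-adic core of the cell (blueprint `HOME/p2/PADIC-CORE.md`) need not
treat `p = 2` — where the points `s/2^J` of the `2`-descent leave `ℤ₂` (risk R4 there) — and no
archimedean estimate is needed to dispense with it (contrast Theorem B of
`Literature/Barriers/ABC/BakerMethodBoundsStewartTijdemanGenericProofs.lean`, which removes `p = 2, 3`
at the price of an archimedean bound for `k log 2 + l log 3 + log ξ`).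

Nothing here is claimed to be in print beyond the summation pattern of Stewart–Tijdeman 1986
[cite: ShoreyTijdeman1986, Ch. 1, proof of Theorem 1.2 (PDF p. 48)].
-/

noncomputable section

open Finset Real
open Literature.NumberTheory.DiophantineGeometry

namespace Summit.ABC.StewartYu

open Literature.Barriers.ABC Literature.Barriers.ABC.StewartTijdemanGeneric

/-- **One odd member against the radical.** Under the odd-prime class bound (`p ≥ 3`), for an odd
positive `x` coprime to `yz` with `x ∣ y² − z²` (`y ≠ z` coprime, `max(y, z) ≤ c`), writing
`R = rad(xyz)` and `Y = max(3, log c)`: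
`log x ≤ 3 M₀ · R^{κ+σ+3τ₁+5/8} · Y^δ · (log Y)^{τ₀}`, `M₀ = 48 K A e^{τ₁} (16(τ₀+1))^{τ₀}`
(`sum_padicPart_le_rad_general` at `p₀ = 3`; all primes of `x` are `≥ 3`). [folklore] -/
theorem log_oddMember_le {K L κ σ δ A : ℝ} {τ₀ τ₁ : ℕ} (hK : 0 ≤ K) (hL : 1 ≤ L)
    (hκ0 : 0 ≤ κ) (hσ0 : 0 ≤ σ) (hδ : 0 < δ) (hδ1 : δ ≤ 1)
    (hP : ∀ (p n : ℕ) (q : Fin n → ℕ) (e : Fin n → ℤ), p.Prime → 3 ≤ p →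
      (∀ i, (q i).Prime) → Function.Injective q → (∀ i, q i ≠ p) → e ≠ 0 →
      ∏ i, ((q i : ℚ)) ^ e i ≠ 1 →
      (padicValRat p (∏ i, ((q i : ℚ)) ^ e i - 1) : ℝ) ≤
        K * L ^ n * (n : ℝ) ^ (κ * n) * (p : ℝ) ^ σ * (∏ i, Real.log (q i)) *
          (Real.log (max 3 ((Finset.univ.sup fun i => (e i).natAbs : ℕ) : ℝ)) + Real.log p +
            ∑ i, Real.log (q i)) ^ (τ₀ + τ₁ * n))
    (hA0 : 0 ≤ A)
    (hA : ∀ S : Finset ℕ, (∀ q ∈ S, q.Prime) →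
      (4 * L * Real.exp κ * (((τ₁ : ℝ) + 1) / δ) ^ τ₁) ^ S.card ≤
        A * (((∏ q ∈ S, q : ℕ)) : ℝ) ^ (1 / 8 : ℝ))
    {x y z c : ℕ} (hx : 0 < x) (hy : 0 < y) (hz : 0 < z) (hyz : y ≠ z) (hcop : Nat.Coprime y z)
    (hxcop : Nat.Coprime x (y * z)) (hdvd : (x : ℤ) ∣ (y : ℤ) ^ 2 - (z : ℤ) ^ 2)
    (hodd : ¬ 2 ∣ x) (hyc : y ≤ c) (hzc : z ≤ c) :
    Real.log x ≤ 3 * (48 * K * A * Real.exp τ₁ * (16 * ((τ₀ : ℝ) + 1)) ^ τ₀) *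
      (((∏ q ∈ (x * (y * z)).primeFactors, q : ℕ)) : ℝ) ^ (κ + σ + 3 * τ₁ + 5 / 8 : ℝ) *
      (max 3 (Real.log c)) ^ δ * Real.log (max 3 (Real.log c)) ^ τ₀ := by
  classical
  have hx0 : x ≠ 0 := hx.ne'
  have hmem := sum_padicPart_le_rad_general (p₀ := 3) hK hL hκ0 hσ0 hδ hP hA0 hA hx hy hz hyz hcop
    hxcop hdvd
  -- every prime of `x` is `≥ 3`
  have hfilter : x.primeFactors.filter (fun p => 3 ≤ p) = x.primeFactors := by
    refine Finset.filter_true_of_mem fun p hp => ?_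
    have hpP := Nat.prime_of_mem_primeFactors hp
    have hp2 : p ≠ 2 := fun h => hodd (h ▸ Nat.dvd_of_mem_primeFactors hp)
    have := hpP.two_le
    omega
  have hlogx : Real.log x = ∑ p ∈ x.primeFactors, (x.factorization p : ℝ) * Real.log p := by
    have h1 := Nat.prod_primeFactors_pow_factorization hx0
    have h2 : (x : ℝ) = ∏ p ∈ x.primeFactors, (p : ℝ) ^ x.factorization p := by
      exact_mod_cast h1
    rw [h2, Real.log_prod]
    · exact Finset.sum_congr rfl fun p _ => Real.log_pow _ _
    · intro p hp
      exact pow_ne_zero _ (by exact_mod_cast (Nat.prime_of_mem_primeFactors hp).ne_zero)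
  rw [hfilter, ← hlogx] at hmem
  -- the logarithms against `Y = max(3, log c)`
  set Y : ℝ := max 3 (Real.log c) with hYdef
  have hY3 : (3 : ℝ) ≤ Y := le_max_left _ _
  have hmaxpos : (0 : ℝ) < (max y z : ℕ) := by exact_mod_cast lt_max_of_lt_left hy
  have hc0 : 0 < c := lt_of_lt_of_le hy hyc
  have hmaxc : Real.log (max y z : ℕ) ≤ Real.log c :=
    Real.log_le_log hmaxpos (by exact_mod_cast (max_le hyc hzc : max y z ≤ c))
  have hW : Real.log (max 3 (Real.log (max y z : ℕ))) ^ τ₀ ≤ Real.log Y ^ τ₀ := by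
    apply pow_le_pow_left₀ (Real.log_nonneg (le_trans (by norm_num) (le_max_left _ _)))
    exact Real.log_le_log (lt_of_lt_of_le (by norm_num) (le_max_left _ _))
      (max_le_max le_rfl hmaxc)
  have hY₃ : (max 3 (3 * Real.log (max y z : ℕ)) : ℝ) ^ δ ≤ 3 * Y ^ δ := by
    have hle : (max 3 (3 * Real.log (max y z : ℕ)) : ℝ) ≤ 3 * Y :=
      max_le (by linarith) (by linarith [le_max_right 3 (Real.log c)])
    have h0 : (0 : ℝ) ≤ max 3 (3 * Real.log (max y z : ℕ)) := le_trans (by norm_num) (le_max_left _ _)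
    calc (max 3 (3 * Real.log (max y z : ℕ)) : ℝ) ^ δ ≤ (3 * Y) ^ δ :=
          Real.rpow_le_rpow h0 hle hδ.le
      _ = (3 : ℝ) ^ δ * Y ^ δ := Real.mul_rpow (by norm_num) (by linarith)
      _ ≤ 3 * Y ^ δ := by
          apply mul_le_mul_of_nonneg_right _ (Real.rpow_nonneg (by linarith) δ)
          calc (3 : ℝ) ^ δ ≤ (3 : ℝ) ^ (1 : ℝ) :=
                Real.rpow_le_rpow_of_exponent_le (by norm_num) hδ1
            _ = 3 := Real.rpow_one 3
  set M₀ : ℝ := 48 * K * A * Real.exp τ₁ * (16 * ((τ₀ : ℝ) + 1)) ^ τ₀ with hM₀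
  set R : ℝ := (((∏ q ∈ (x * (y * z)).primeFactors, q : ℕ)) : ℝ) with hR
  have hRμ0 : (0 : ℝ) ≤ R ^ (κ + σ + 3 * τ₁ + 5 / 8 : ℝ) := by positivity
  calc Real.log x ≤ M₀ * R ^ (κ + σ + 3 * τ₁ + 5 / 8 : ℝ) *
        (max 3 (3 * Real.log (max y z : ℕ))) ^ δ * Real.log (max 3 (Real.log (max y z : ℕ))) ^ τ₀ :=
        hmem
    _ ≤ M₀ * R ^ (κ + σ + 3 * τ₁ + 5 / 8 : ℝ) * (3 * Y ^ δ) * Real.log Y ^ τ₀ := by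
        apply mul_le_mul _ hW (pow_nonneg (Real.log_nonneg (le_trans (by norm_num)
          (le_max_left _ _))) τ₀) (by positivity)
        exact mul_le_mul_of_nonneg_left hY₃ (by positivity)
    _ = 3 * M₀ * R ^ (κ + σ + 3 * τ₁ + 5 / 8 : ℝ) * Y ^ δ * Real.log Y ^ τ₀ := by ring

/-- **Socket A⁺ at the odd primes.** The conclusion of `bakerShapeBound_of_primePadicBound_general`
(`log c ≤ C · rad(abc)^{κ+σ+3τ₁+1}` for every abc triple) already follows from the class bound at the
ODD primes `p ≥ 3` alone, with no archimedean input: if `c` is odd expand `c`, otherwise `a, b` are odd,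
and (for `a < b`) `c < 2b`, so expand `b` (`b ∣ c² − a²`); `log 2` is absorbed by the constant. This
dispenses the `p`-adic core with the prime `2` (where the `2`-descent points `s/2^J` leave `ℤ₂`).
[folklore] -/
theorem bakerShapeBound_of_oddPrimePadicBound_general {K L κ σ : ℝ} {τ₀ τ₁ : ℕ} (hK : 0 ≤ K)
    (hL : 1 ≤ L) (hκ0 : 0 ≤ κ) (hσ0 : 0 ≤ σ)
    (hP : ∀ (p n : ℕ) (q : Fin n → ℕ) (e : Fin n → ℤ), p.Prime → 3 ≤ p →
      (∀ i, (q i).Prime) → Function.Injective q → (∀ i, q i ≠ p) → e ≠ 0 →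
      ∏ i, ((q i : ℚ)) ^ e i ≠ 1 →
      (padicValRat p (∏ i, ((q i : ℚ)) ^ e i - 1) : ℝ) ≤
        K * L ^ n * (n : ℝ) ^ (κ * n) * (p : ℝ) ^ σ * (∏ i, Real.log (q i)) *
          (Real.log (max 3 ((Finset.univ.sup fun i => (e i).natAbs : ℕ) : ℝ)) + Real.log p +
            ∑ i, Real.log (q i)) ^ (τ₀ + τ₁ * n)) :
    BakerShapeBound (κ + σ + 3 * τ₁ + 1) 0 := by
  classical
  set θ : ℝ := κ + σ + 3 * τ₁ + 1 with hθ
  set μ : ℝ := κ + σ + 3 * τ₁ + 5 / 8 with hμ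
  have hθ1 : 1 ≤ θ := by
    rw [hθ]; have : (0 : ℝ) ≤ 3 * (τ₁ : ℝ) := by positivity
    linarith
  have hθ0 : 0 < θ := by linarith
  have hμ0 : 0 ≤ μ := by rw [hμ]; positivity
  set δ : ℝ := 1 / (8 * θ) with hδ
  have hδ0 : 0 < δ := by rw [hδ]; positivity
  have hδθ : δ * θ = 1 / 8 := by rw [hδ]; field_simp
  have hδ1 : δ ≤ 1 := by
    rw [hδ, div_le_one (by positivity)]; linarith
  have h2δ : 2 * δ < 1 := by
    have : δ ≤ 1 / 8 := by rw [hδ]; exact one_div_le_one_div_of_le (by norm_num) (by linarith)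
    linarith
  have hμθ : μ ≤ θ * (1 - 2 * δ) := by
    have : θ * (1 - 2 * δ) = θ - 2 * (δ * θ) := by ring
    rw [this, hδθ, hμ, hθ]; linarith
  set C₀ : ℝ := 4 * L * Real.exp κ * (((τ₁ : ℝ) + 1) / δ) ^ τ₁ with hC₀
  have hC₀1 : 1 ≤ C₀ := by
    have h1 : 1 ≤ 4 * L * Real.exp κ := by
      nlinarith [Real.one_le_exp hκ0]
    have h2 : (1 : ℝ) ≤ ((τ₁ : ℝ) + 1) / δ := by
      rw [le_div_iff₀ hδ0]; nlinarith
    rw [hC₀]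
    exact one_le_mul_of_one_le_of_one_le h1 (one_le_pow₀ h2)
  obtain ⟨A, hA1, hA⟩ := exists_pow_card_le_prod_rpow hC₀1 (by norm_num : (0 : ℝ) < 1 / 8)
  have hA0 : 0 ≤ A := zero_le_one.trans hA1
  set M₀ : ℝ := 48 * K * A * Real.exp τ₁ * (16 * ((τ₀ : ℝ) + 1)) ^ τ₀ with hM₀
  have hM₀0 : 0 ≤ M₀ := by rw [hM₀]; positivity
  refine bakerShapeBound_of_loglog_rpow (μ := μ) (τ := τ₀) (M := 3 * M₀ + 1) hμ0 hδ0 h2δ hμθ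
    (by positivity) fun a b c ht => ?_
  -- symmetric in `a, b`: reduce to `a ≤ b`
  have hR1 : (1 : ℝ) ≤ (rad a b c : ℝ) := one_le_rad_real a b c
  have hRμ : (1 : ℝ) ≤ (rad a b c : ℝ) ^ μ := Real.one_le_rpow hR1 hμ0
  set Y : ℝ := max 3 (Real.log c) with hYdef
  have hY3 : (3 : ℝ) ≤ Y := le_max_left _ _
  have hY1 : (1 : ℝ) ≤ Y := le_trans (by norm_num) hY3
  have hl3 : 1 ≤ Real.log 3 := by
    rw [Real.le_log_iff_exp_le (by norm_num)]
    exact Real.exp_one_lt_d9.le.trans (by norm_num)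
  have hlogY1 : 1 ≤ Real.log Y := hl3.trans (Real.log_le_log (by norm_num) hY3)
  have hYδ : 1 ≤ Y ^ δ := Real.one_le_rpow hY1 hδ0.le
  have hlogYτ : 1 ≤ Real.log Y ^ τ₀ := one_le_pow₀ hlogY1
  have hbig : 1 ≤ (rad a b c : ℝ) ^ μ * Y ^ δ * Real.log Y ^ τ₀ :=
    one_le_mul_of_one_le_of_one_le (one_le_mul_of_one_le_of_one_le hRμ hYδ) hlogYτ
  have hbig0 : 0 ≤ (rad a b c : ℝ) ^ μ * Y ^ δ * Real.log Y ^ τ₀ := zero_le_one.trans hbig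
  -- the key bound for `a' < b'` (applied to `(a, b)` or `(b, a)`)
  have key : ∀ {a' b' : ℕ}, IsABCTriple a' b' c → a' < b' → rad a' b' c = rad a b c →
      Real.log c ≤ (3 * M₀ + 1) * (rad a b c : ℝ) ^ μ * Y ^ δ * Real.log Y ^ τ₀ := by
    intro a' b' ht' hab hradeq
    obtain ⟨ha, hb, habc, hcop⟩ := ht'
    have hc0 : c ≠ 0 := by omega
    have hcpos : (0 : ℝ) < c := by exact_mod_cast (show 0 < c by omega)
    have hac : Nat.Coprime a' c := by rw [← habc]; exact Nat.coprime_self_add_right.mpr hcop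
    have hbc : Nat.Coprime b' c := by rw [← habc]; exact Nat.coprime_add_self_right.mpr hcop.symm
    have hrad3 : ∀ x y z : ℕ, x * (y * z) = a' * b' * c →
        (((∏ q ∈ (x * (y * z)).primeFactors, q : ℕ)) : ℝ) = (rad a b c : ℝ) := by
      intro x y z hxyz
      rw [← hradeq, rad_def, Nat.radical_eq_prod_primeFactors, hxyz]
    by_cases h2c : 2 ∣ c
    · -- `c` even: `a', b'` odd, expand `b'` (`b' ∣ c² − a'²`, `c < 2 b'`)
      have hb_odd : ¬ 2 ∣ b' := fun h =>
        (Nat.Prime.one_lt Nat.prime_two).ne' (Nat.eq_one_of_dvd_coprimes hbc h h2c)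
      have hcopb : Nat.Coprime b' (c * a') := Nat.Coprime.mul_right hbc hcop.symm
      have hdvd : (b' : ℤ) ∣ (c : ℤ) ^ 2 - (a' : ℤ) ^ 2 :=
        ⟨(c : ℤ) + a', by rw [← habc]; push_cast; ring⟩
      have hca : c ≠ a' := by omega
      have hmem := log_oddMember_le (c := c) hK hL hκ0 hσ0 hδ0 hδ1 hP hA0 hA hb (by omega) ha hca
        hac.symm hcopb hdvd hb_odd le_rfl (by omega)
      rw [hrad3 b' c a' (by ring)] at hmem
      have hc2b : (c : ℝ) ≤ 2 * b' := by exact_mod_cast (show c ≤ 2 * b' by omega)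
      have hlogc : Real.log c ≤ Real.log 2 + Real.log b' := by
        rw [← Real.log_mul (by norm_num) (by exact_mod_cast hb.ne')]
        exact Real.log_le_log hcpos hc2b
      have hlog2 : Real.log 2 ≤ 1 := by linarith [Real.log_two_lt_d9]
      calc Real.log c ≤ Real.log 2 + Real.log b' := hlogc
        _ ≤ 1 * ((rad a b c : ℝ) ^ μ * Y ^ δ * Real.log Y ^ τ₀) +
              3 * M₀ * (rad a b c : ℝ) ^ μ * Y ^ δ * Real.log Y ^ τ₀ := by
            apply add_le_add
            · rw [one_mul]; exact hlog2.trans hbig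
            · rw [hM₀, hμ]; exact hmem
        _ = (3 * M₀ + 1) * (rad a b c : ℝ) ^ μ * Y ^ δ * Real.log Y ^ τ₀ := by ring
    · -- `c` odd: expand `c` (`c ∣ a'² − b'²`)
      have hcopc : Nat.Coprime c (a' * b') := (Nat.Coprime.mul_left hac hbc).symm
      have hdvd : (c : ℤ) ∣ (a' : ℤ) ^ 2 - (b' : ℤ) ^ 2 :=
        ⟨(a' : ℤ) - b', by rw [← habc]; push_cast; ring⟩
      have hmem := log_oddMember_le (c := c) hK hL hκ0 hσ0 hδ0 hδ1 hP hA0 hA (by omega) ha hb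
        (by omega) hcop hcopc hdvd h2c (by omega) (by omega)
      rw [hrad3 c a' b' (by ring)] at hmem
      calc Real.log c ≤ 3 * M₀ * (rad a b c : ℝ) ^ μ * Y ^ δ * Real.log Y ^ τ₀ := by
            rw [hM₀, hμ]; exact hmem
        _ ≤ (3 * M₀ + 1) * (rad a b c : ℝ) ^ μ * Y ^ δ * Real.log Y ^ τ₀ := by
            have : 0 ≤ 1 * ((rad a b c : ℝ) ^ μ * Y ^ δ * Real.log Y ^ τ₀) := by positivity
            nlinarith
  obtain ⟨ha, hb, habc, hcop⟩ := ht
  rcases lt_trichotomy a b with hab | rfl | hba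
  · exact key ⟨ha, hb, habc, hcop⟩ hab rfl
  · -- `a = b = 1`, `c = 2`
    have ha1 : a = 1 := Nat.Coprime.eq_one_of_dvd hcop (dvd_refl a)
    have hc2 : c = 2 := by omega
    subst hc2
    have h2 : Real.log ((2 : ℕ) : ℝ) ≤ 1 := by
      push_cast; linarith only [Real.log_two_lt_d9]
    have h1 : (1 : ℝ) ≤ 3 * M₀ + 1 := by linarith
    calc Real.log ((2 : ℕ) : ℝ) ≤ 1 := h2
      _ ≤ (3 * M₀ + 1) * ((rad a a 2 : ℝ) ^ μ * Y ^ δ * Real.log Y ^ τ₀) :=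
          one_le_mul_of_one_le_of_one_le h1 hbig
      _ = (3 * M₀ + 1) * (rad a a 2 : ℝ) ^ μ * Y ^ δ * Real.log Y ^ τ₀ := by ring
  · have hrad : rad b a c = rad a b c := by rw [rad_def, rad_def, mul_comm b a]
    exact key ⟨hb, ha, by omega, hcop.symm⟩ hba hrad

/-- **Stewart–Tijdeman 1986 (`log c ≤ κ R^{15}`) from the odd-prime socket** whenever
`κ + σ + 3τ₁ + 1 ≤ 15`. [cite: StewartTijdeman1986, Theorem 1 (upper bound), as quoted in
Waldschmidt2014 §2 (PDF p. 3)] -/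
theorem stewartTijdeman1986_of_oddPrimePadicBound_general {K L κ σ : ℝ} {τ₀ τ₁ : ℕ} (hK : 0 ≤ K)
    (hL : 1 ≤ L) (hκ0 : 0 ≤ κ) (hσ0 : 0 ≤ σ) (h15 : κ + σ + 3 * τ₁ + 1 ≤ 15)
    (hP : ∀ (p n : ℕ) (q : Fin n → ℕ) (e : Fin n → ℤ), p.Prime → 3 ≤ p →
      (∀ i, (q i).Prime) → Function.Injective q → (∀ i, q i ≠ p) → e ≠ 0 →
      ∏ i, ((q i : ℚ)) ^ e i ≠ 1 →
      (padicValRat p (∏ i, ((q i : ℚ)) ^ e i - 1) : ℝ) ≤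
        K * L ^ n * (n : ℝ) ^ (κ * n) * (p : ℝ) ^ σ * (∏ i, Real.log (q i)) *
          (Real.log (max 3 ((Finset.univ.sup fun i => (e i).natAbs : ℕ) : ℝ)) + Real.log p +
            ∑ i, Real.log (q i)) ^ (τ₀ + τ₁ * n)) :
    stewartTijdeman1986_upperBound :=
  bakerShapeBound_zero_mono h15 (bakerShapeBound_of_oddPrimePadicBound_general hK hL hκ0 hσ0 hP)


/-! ### Adapter: the `_logRad` door shape at the odd primes ⇒ socket A⁺ at the odd primes -/

/-- **The `_logRad` shape at the odd primes suffices.** If for every odd prime `p`, all distinct primes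
`qᵢ ≠ p` and `e ≠ 0` with `∏ qᵢ^{eᵢ} ≠ 1`,
`ord_p(∏ qᵢ^{eᵢ} − 1) ≤ K Lⁿ n^{κn} p^σ (∏ log qᵢ) (log max(3, max|eᵢ|))^τ (log max(3, ∏ qᵢ))^{τ₁}`
(the one-prime hypothesis of `Literature.Barriers.ABC.stewartTijdeman1986_of_primePadicBound_logRad`,
= `AbcStewartYuPlan.PrimePadicBoundAt p K L κ σ τ τ₁` of the cell's skeleton), then
`BakerShapeBound (κ + σ + 1) 0`; since `log max(3, max|eᵢ|), log max(3, ∏ qᵢ) ≤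
log max(3, max|eᵢ|) + log p + ∑ log qᵢ`, this is `bakerShapeBound_of_oddPrimePadicBound_general` with
`τ₀ = τ + τ₁`, `τ₁ = 0`. [folklore] -/
theorem bakerShapeBound_of_oddPrime_logRadShape {K L κ σ : ℝ} {τ τ₁ : ℕ} (hK : 0 ≤ K) (hL : 1 ≤ L)
    (hκ0 : 0 ≤ κ) (hσ0 : 0 ≤ σ)
    (hP : ∀ (p : ℕ), p.Prime → p ≠ 2 → ∀ (n : ℕ) (q : Fin n → ℕ) (e : Fin n → ℤ),
      (∀ i, (q i).Prime) → Function.Injective q → (∀ i, q i ≠ p) → e ≠ 0 →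
      ∏ i, ((q i : ℚ)) ^ e i ≠ 1 →
      (padicValRat p (∏ i, ((q i : ℚ)) ^ e i - 1) : ℝ) ≤
        K * L ^ n * (n : ℝ) ^ (κ * n) * (p : ℝ) ^ σ * (∏ i, Real.log (q i)) *
          Real.log (max 3 ((Finset.univ.sup fun i => (e i).natAbs : ℕ) : ℝ)) ^ τ *
          Real.log (max 3 (∏ i, ((q i : ℕ) : ℝ))) ^ τ₁) :
    BakerShapeBound (κ + σ + 1) 0 := by
  have h := bakerShapeBound_of_oddPrimePadicBound_general (τ₀ := τ + τ₁) (τ₁ := 0) hK hL hκ0 hσ0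
    (fun p n q e hp hp3 hq hinj hqp he hne1 => by
      have hp2 : p ≠ 2 := by omega
      have key := hP p hp hp2 n q e hq hinj hqp he hne1
      refine key.trans ?_
      -- compare the logarithmic factors
      set S : ℝ := Real.log (max 3 ((Finset.univ.sup fun i => (e i).natAbs : ℕ) : ℝ)) + Real.log p +
        ∑ i, Real.log (q i) with hS
      have hl3 : 1 ≤ Real.log 3 := by
        rw [Real.le_log_iff_exp_le (by norm_num)]
        exact Real.exp_one_lt_d9.le.trans (by norm_num)
      have hLB3 : Real.log 3 ≤ Real.log (max 3 ((Finset.univ.sup fun i => (e i).natAbs : ℕ) : ℝ)) :=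
        Real.log_le_log (by norm_num) (le_max_left _ _)
      have hLB0 : 0 ≤ Real.log (max 3 ((Finset.univ.sup fun i => (e i).natAbs : ℕ) : ℝ)) := by
        linarith
      have hlp0 : 0 ≤ Real.log p := Real.log_nonneg (by exact_mod_cast hp.one_lt.le)
      have hsum0 : 0 ≤ ∑ i, Real.log (q i) := Finset.sum_nonneg fun i _ =>
        Real.log_nonneg (by exact_mod_cast (hq i).one_lt.le)
      have hLB_le : Real.log (max 3 ((Finset.univ.sup fun i => (e i).natAbs : ℕ) : ℝ)) ≤ S := by
        rw [hS]; linarith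
      have hP1 : (1 : ℝ) ≤ ∏ i, ((q i : ℕ) : ℝ) := by
        rw [← Nat.cast_prod]; exact_mod_cast Finset.prod_pos fun i _ => (hq i).pos
      have hLQ_le : Real.log (max 3 (∏ i, ((q i : ℕ) : ℝ))) ≤ S := by
        have hle : max 3 (∏ i, ((q i : ℕ) : ℝ)) ≤ 3 * ∏ i, ((q i : ℕ) : ℝ) :=
          max_le (by linarith) (by linarith)
        have hlogP : Real.log (∏ i, ((q i : ℕ) : ℝ)) = ∑ i, Real.log (q i) :=
          Real.log_prod (s := Finset.univ) (fun i _ => by exact_mod_cast (hq i).ne_zero)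
        calc Real.log (max 3 (∏ i, ((q i : ℕ) : ℝ))) ≤ Real.log (3 * ∏ i, ((q i : ℕ) : ℝ)) :=
              Real.log_le_log (lt_of_lt_of_le (by norm_num) (le_max_left _ _)) hle
          _ = Real.log 3 + ∑ i, Real.log (q i) := by
              rw [Real.log_mul (by norm_num) (by linarith), hlogP]
          _ ≤ S := by rw [hS]; linarith
      have hLQ0 : 0 ≤ Real.log (max 3 (∏ i, ((q i : ℕ) : ℝ))) :=
        Real.log_nonneg (le_trans (by norm_num) (le_max_left _ _))
      have hlogs : Real.log (max 3 ((Finset.univ.sup fun i => (e i).natAbs : ℕ) : ℝ)) ^ τ *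
          Real.log (max 3 (∏ i, ((q i : ℕ) : ℝ))) ^ τ₁ ≤ S ^ (τ + τ₁ + 0 * n) := by
        rw [zero_mul, add_zero, pow_add]
        exact mul_le_mul (pow_le_pow_left₀ hLB0 hLB_le τ) (pow_le_pow_left₀ hLQ0 hLQ_le τ₁)
          (pow_nonneg hLQ0 τ₁) (pow_nonneg (hLB0.trans hLB_le) τ)
      have hpre : 0 ≤ K * L ^ n * (n : ℝ) ^ (κ * n) * (p : ℝ) ^ σ * (∏ i, Real.log (q i)) := by
        have : 0 ≤ L ^ n := pow_nonneg (zero_le_one.trans hL) n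
        have : 0 ≤ ∏ i, Real.log (q i) := Finset.prod_nonneg fun i _ =>
          Real.log_nonneg (by exact_mod_cast (hq i).one_lt.le)
        positivity
      calc K * L ^ n * (n : ℝ) ^ (κ * n) * (p : ℝ) ^ σ * (∏ i, Real.log (q i)) *
            Real.log (max 3 ((Finset.univ.sup fun i => (e i).natAbs : ℕ) : ℝ)) ^ τ *
            Real.log (max 3 (∏ i, ((q i : ℕ) : ℝ))) ^ τ₁
          = K * L ^ n * (n : ℝ) ^ (κ * n) * (p : ℝ) ^ σ * (∏ i, Real.log (q i)) *
            (Real.log (max 3 ((Finset.univ.sup fun i => (e i).natAbs : ℕ) : ℝ)) ^ τ *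
            Real.log (max 3 (∏ i, ((q i : ℕ) : ℝ))) ^ τ₁) := by ring
        _ ≤ K * L ^ n * (n : ℝ) ^ (κ * n) * (p : ℝ) ^ σ * (∏ i, Real.log (q i)) *
            S ^ (τ + τ₁ + 0 * n) := mul_le_mul_of_nonneg_left hlogs hpre)
  simpa using h

/-- **Stewart–Tijdeman 1986 from the `_logRad` shape at the odd primes**, `κ + σ + 1 ≤ 15`.
[cite: StewartTijdeman1986, Theorem 1 (upper bound), as quoted in Waldschmidt2014 §2 (PDF p. 3)] -/
theorem stewartTijdeman1986_of_oddPrime_logRadShape {K L κ σ : ℝ} {τ τ₁ : ℕ} (hK : 0 ≤ K)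
    (hL : 1 ≤ L) (hκ0 : 0 ≤ κ) (hσ0 : 0 ≤ σ) (h15 : κ + σ + 1 ≤ 15)
    (hP : ∀ (p : ℕ), p.Prime → p ≠ 2 → ∀ (n : ℕ) (q : Fin n → ℕ) (e : Fin n → ℤ),
      (∀ i, (q i).Prime) → Function.Injective q → (∀ i, q i ≠ p) → e ≠ 0 →
      ∏ i, ((q i : ℚ)) ^ e i ≠ 1 →
      (padicValRat p (∏ i, ((q i : ℚ)) ^ e i - 1) : ℝ) ≤
        K * L ^ n * (n : ℝ) ^ (κ * n) * (p : ℝ) ^ σ * (∏ i, Real.log (q i)) *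
          Real.log (max 3 ((Finset.univ.sup fun i => (e i).natAbs : ℕ) : ℝ)) ^ τ *
          Real.log (max 3 (∏ i, ((q i : ℕ) : ℝ))) ^ τ₁) :
    stewartTijdeman1986_upperBound :=
  bakerShapeBound_zero_mono h15 (bakerShapeBound_of_oddPrime_logRadShape hK hL hκ0 hσ0 hP)

end Summit.ABC.StewartYu

end
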